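/-
HODGE LADDER — STAGE 4 («abelian motivic type») TYPED SCOPING ENTRIES (literature seat hodge-director-lit-stage4,
2026-08-20). SCOPING ONLY: nothing in this file is asserted. Every entry is either
(a) a NAME for an existing tree declaration (the published input, CITE), or
(b) a `@[conjecture]` TARGET / JUNCTION proposition (an open statement, or an implication shape the ladder would have
    to PROVE in the tree; never a published theorem), or
(c) trivial KERNEL wiring between (a) and (b).
Companion document: run/shared/lean/pub/hodge-director/STAGE4-ABELIAN-MOTIVIC-TYPE.md (statements (a)/(b)/(c) per class,
with the printed sources).  Kept OUT of `CorCM/Interfaces.lean` on purpose: that file's md5 is stage 2's SKELETON-ACK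
condition C1.
-/
import Summits.HodgeConjecture.HodgeConjecture.Theses.PadicSemiregularLift
import Summits.HodgeConjecture.CorCM.Interfaces
import Literature.AlgebraicGeometry.Surfaces.K3ComplexMultiplication
import Literature.AlgebraicGeometry.Hyperkaehler.MarkmanRationalHodgeIsometries
import Literature.AlgebraicGeometry.Motives.KugaSatakeCorrespondenceByRank
import Literature.AlgebraicGeometry.Motives.MotivatedPeriodTorsor
import Literature.AlgebraicGeometry.HodgeTheory.CubicFourfoldHodgeConjectureAllDegrees
import Literature.AlgebraicGeometry.HodgeTheory.LefschetzOneOneHolds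
import Literature.AlgebraicGeometry.HodgeTheory.FermatHodgeOfCMHodgeHypothesis
import Literature.AlgebraicGeometry.HodgeTheory.MotivatedClassesHodgeConjecture
import Literature.AlgebraicGeometry.HodgeTheory.LefschetzStandardConjectureFacts
import Literature.AlgebraicGeometry.ShimuraVarieties.BallQuotientHodgeClasses
import Literature.Barriers.HodgeConjecture.HodgeLocusAlgebraic
import Literature.AlgebraicGeometry.Hyperkaehler.GeneralizedKummerTypeHodgeConjecture
import Literature.AlgebraicGeometry.Hyperkaehler.K3HilbertTypeLefschetzStandard
import Literature.AlgebraicGeometry.Hyperkaehler.HodgeClassesMotivated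
import Literature.AlgebraicGeometry.Motives.AbelianVarietyProjectiveChart
import Summits.HodgeConjecture.HodgeConjecture.Theorems.EndoscopicMiddleDegreeCupProductAlgebraic
import HarnessLib

/-!
# Stage 4 of the Hodge ladder — «abelian motivic type»: typed scoping entries

Stage 3 concludes `HC_AV` (`Theses.PadicSemiregularLift.HodgeAbelianVarieties`, BY NAME).  Stage 4 asks which classes of
varieties would INHERIT the Hodge conjecture from `HC_AV` through PUBLISHED reductions.  The printed spine (André, Publ.
Math. IHÉS 83 (1996)): Thm. 0.6.2 (p. 9) Hodge cycles on abelian varieties are motivated; Thm. 0.6.3 (p. 9) / Thm. 7.1–7.2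
(p. 35) the motive of a projective K3 surface, resp. of a smooth cubic hypersurface in `ℙⁿ`, `n ≤ 6`, lies in the
tannakian category `M(Ab)_V` generated by abelian varieties (motivated correspondences); §0.3 (p. 7) motivated cycles ARE
algebraic cycles as soon as the Lefschetz involution `*_L` of every base piece is algebraic (Grothendieck's `B`); §6.3
Remarque 2 (p. 33) reduces `HC_AV` itself to the algebraicity of `*_L` on compact pencils of abelian varieties.
CONSEQUENCE FOR THE LADDER (recorded, not asserted): for every class below, `HC_AV` alone is never the only input — one
needs IN ADDITION the ALGEBRAICITY of the motivated isomorphism with an abelian motive (Kuga–Satake–Hodge conjecture,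
van Geemen 2000 §10.2; Beauville–Donagi + Kuga–Satake for cubic fourfolds) — or else `B` for the auxiliary total spaces,
which by André §0.3 + Thm. 0.6.2 yields `HC_AV` too and so bypasses stage 3.

Per class this file records: TARGET (`@[conjecture]`), the published INPUTS by name (CITE = existing tree declarations),
and the JUNCTION SHAPE `inputs → HC_AV → target` as a `@[conjecture]` (an implication to be PROVED in the tree, like
stage 2's `HC_CM_of_PerLFace`; no printed theorem has exactly this shape unless said so in the companion document).
-/

noncomputable section

open CategoryTheory MonoidalCategory
open Literature.AlgebraicGeometry
open Literature.AlgebraicGeometry.Motives (SchemeOver IsSmoothProjective AbelianVariety BettiHodgeData)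
open Literature.AlgebraicGeometry.HodgeTheory
open Literature.AlgebraicGeometry.Surfaces (IsK3Surface HasComplexMultiplication)
open Literature.AlgebraicGeometry.Hyperkaehler (IsOfK3HilbertType IsOfGeneralizedKummerType)

namespace Summit.HodgeConjecture.CorCM.Stage4

/-! ## Stage 3's conclusion, by name -/

/-- **`HC_AV`** — the Hodge conjecture for all complex abelian varieties, BY NAME: ring2's
`Theses.PadicSemiregularLift.HodgeAbelianVarieties` (`∀ A : AbelianVariety ℂ, HodgeConjectureFor A.dim A.X`). [folklore] -/
abbrev HC_AV : Prop := Summit.HodgeConjecture.HodgeConjecture.Theses.PadicSemiregularLift.HodgeAbelianVarieties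

/-- `HC_AV` unfolds to the Hodge conjecture for every complex abelian variety (definitional). [folklore] -/
theorem hc_av_iff : HC_AV ↔ ∀ A : AbelianVariety ℂ, HodgeConjectureFor A.dim A.X := Iff.rfl

/-! ## Row 1 — K3 surfaces: products and powers -/

/-- TARGET (row 1a): the Hodge conjecture for every cartesian power `Sᵐ` (`Motives.SchemeOver.pow`, dimension `m * 2`)
of every complex projective K3 surface.  OPEN for `m ≥ 2` in general (Varesco 2023 §0.1: "In general, it is not known
whether Hodge morphisms of transcendental lattices are algebraic or not"); known sub-cases are CITE entries below and in the
companion document. [cite: Varesco2023, §0.1–0.2] -/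
@[conjecture] def HC_K3Powers : Prop :=
  ∀ ⦃S : SchemeOver ℂ⦄, IsK3Surface S → ∀ m : ℕ, HodgeConjectureFor (m * 2) (S.pow m)

/-- TARGET (row 1b): the Hodge conjecture for the product of two complex projective K3 surfaces (equivalently:
every element of `Hom_Hdg(T(S), T(S'))` is algebraic, Varesco 2023 §0.2).  OPEN in general; Hodge ISOMETRIES are
algebraic (Buskin 2019 Thm. 1.1 = `Surfaces.Buskin2019_hodgeIsometry_algebraic`). [cite: Varesco2023, §0.2]
[cite: Buskin2019, Thm. 1.1] -/
@[conjecture] def HC_K3Pairs : Prop :=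
  ∀ ⦃S S' : SchemeOver ℂ⦄, IsK3Surface S → IsK3Surface S' → HodgeConjectureFor 4 (S ⊗ S')

/-- INPUT BEYOND `HC_AV` (row 1), published OPEN conjecture, BY NAME in the tree's framework `B`: the Kuga–Satake–Hodge
conjecture (van Geemen 2000, 10.2; Huybrechts, K3 book, Ch. 4 Conj. 2.11) for every complex projective K3 surface, in
every Betti–Hodge realization datum `B`. [cite: vanGeemen2000KugaSatakeHC, §10.2] [cite: Huybrechts2016K3, Ch. 4 Conj. 2.11] -/
@[conjecture] def KSH_K3 : Prop :=
  ∀ (B : BettiHodgeData ℂ) ⦃S : SchemeOver ℂ⦄ (hS : IsK3Surface S),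
    B.KugaSatakeHodgeConjectureFor hS.isSmoothProjective

/-- JUNCTION SHAPE (row 1; to be PROVED, not a printed theorem): Kuga–Satake–Hodge for K3 surfaces AND `HC_AV` ⟹ the
Hodge conjecture for all powers of K3 surfaces.  Printed ingredients: vG 2000 §10.3 (KSH is the instance of HC on
`A² × S`), André 1996 Thm. 7.1 (the K3 motive is cut on its Kuga–Satake variety by MOTIVATED correspondences), transfer of
algebraic classes along algebraic correspondences (Fulton 19.2 / Voisin II 9.20, the tree's
`Voisin2003_cupProduct_algebraicClasses`).  CARRIER NOTE: `KSH_K3` lives in framework `B`, the conclusion on real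
carriers; a real-carrier Kuga–Satake class is a definition request (companion document §10). [cite: vanGeemen2000KugaSatakeHC, §10.3]
[cite: Andre1996Motifs, Thm. 7.1 (p. 35)] -/
@[conjecture] def HC_K3Powers_of_KSH : Prop := KSH_K3 → HC_AV → HC_K3Powers

/-- CITE (row 1, known sub-case), kernel wiring: Buskin 2019 Corollary / Huybrechts 2019 Cor. 0.4 (ii) BY NAME gives the
row-1b target for the self-product of a K3 surface with complex multiplication. [cite: Buskin2019, Corollary after Thm. 1.1]
[cite: Huybrechts2019, Cor. 0.4 (ii)] -/
theorem hc_square_of_CM (h : Surfaces.Buskin2019_hodgeConjectureFor_square_of_CM) {S : SchemeOver ℂ}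
    (hS : IsK3Surface S) (hCM : HasComplexMultiplication S) : HodgeConjectureFor 4 (S ⊗ S) :=
  h S hS hCM

/-! ## Row 2 — hyperkähler varieties of `K3^[n]`-type (and generalized Kummer type) -/

/-- TARGET (row 2a): the Hodge conjecture for every smooth projective variety of `K3^[n]`-type (`n ≥ 2`).  OPEN; printed
partial results: Charles–Markman 2013 Thm. 1.1 (standard conjecture `B`), Markman 2024 Thm. 1.1 (rational Hodge
isometries of `H²` algebraic = `Hyperkaehler.Markman2024_rationalHodgeIsometry_algebraic`), Soldatenkov 2022 Cor. 1.2
(André motive abelian ⟹ all Hodge classes absolute Hodge). [cite: CharlesMarkman2013, Thm. 1.1] [cite: Markman2024, Thm. 1.1]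
[cite: Soldatenkov2022, Cor. 1.2] -/
@[conjecture] def HC_K3HilbertType : Prop :=
  ∀ (n : ℕ), 2 ≤ n → ∀ ⦃X : SchemeOver ℂ⦄, IsSmoothProjective (2 * n) X → IsOfK3HilbertType n X →
    HodgeConjectureFor (2 * n) X

/-- JUNCTION SHAPE (row 2a; to be PROVED, not printed in this form): for `K3^[n]`-type the printed road is André's —
Soldatenkov 2022 Cor. 1.2 (André motive abelian, via the Kuga–Satake embedding of Kurnosov–Soldatenkov–Verbitsky being
MOTIVATED) makes every Hodge class motivated; `B` for the auxiliary base pieces then makes them algebraic (André §0.3).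
Here `B` is the tree's real-carrier `StandardConjectureBStar` for ALL smooth projective complex varieties — an input that
by André Thm. 0.6.2 also yields `HC_AV`, displayed nevertheless so that the junction has the ladder's shape.
[cite: Soldatenkov2022, Thm. 1.1 and Cor. 1.2] [cite: Andre1996Motifs, §0.3 (p. 7) and Thm. 0.6.2 (p. 9)] -/
@[conjecture] def HC_K3HilbertType_of_B : Prop :=
  (∀ (d : ℕ) (Z : SchemeOver ℂ) (η : complexBetti Z 2), IsSmoothProjective d Z → StandardConjectureBStar d Z η) →
    HC_AV → HC_K3HilbertType

/-! Row 2b (generalized Kummer type) has NO typed target here: the tree has no predicate `IsOfGeneralizedKummerType n X`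
(definition request in the companion document §10).  In print the Hodge conjecture is a THEOREM for `Kum²`- and
`Kum³`-type (Floccari–Varesco 2024 Cor. 1.2; Floccari 2023 Thm. 1.1) and holds on the subalgebra generated by `H²` for all
`Kumⁿ` (Floccari–Varesco 2024 Thm. 1.1) — CITE rows owed once the predicate exists; nothing there depends on `HC_AV`. -/

/-! ## Row 3 — cubic fourfolds -/

/-- CITE (row 3), kernel wiring: the Hodge conjecture for a smooth cubic fourfold is a THEOREM in print (Zucker 1977,
(3.2) p. 206; Murre 1977), BY NAME the tree's named fact `hodgeTwoTwo_algebraic_cubicFourfold` assembled to all degrees by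
`hodgeConjectureFor_cubicFourfold_of` (with the tree THEOREMS Lefschetz `(1,1)`, hard Lefschetz, existence of Hodge
models for the other degrees).  Needs NOTHING from `HC_AV`. [cite: Zucker1977, (3.2) Theorem, p. 206] -/
theorem hc_cubicFourfold (h : hodgeTwoTwo_algebraic_cubicFourfold) {X : SchemeOver ℂ}
    (hX : Motives.IsSmoothHypersurface 4 3 X) : HodgeConjectureFor 4 X :=
  hodgeConjectureFor_cubicFourfold_of h lefschetzOneOne_rational_holds (nonempty_hardLefschetzNFold_holds 4 X)
    nonempty_hodgeModel_holds hX

/-- TARGET (row 3b): the Hodge conjecture for cartesian powers of smooth cubic fourfolds.  By Beauville–Donagi 1985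
(Huybrechts, *The Geometry of Cubic Hypersurfaces*, Ch. 6 Prop. 3.19: the Fano correspondence is an isomorphism of Hodge
structures `H⁴(X, ℤ) ≅ H²(F(X), ℤ)(-1)`, `F(X)` of `K3^[2]`-type, Thm. 3.10/Cor. 3.11) and André 1996 Thm. 7.2 (`h(X) ∈
M(Ab)_V` via weight-4 Kuga–Satake) this row has the status of row 2a: OPEN, beyond `HC_AV` it needs the algebraicity
of the weight-4 Kuga–Satake correspondence (or `B`). [cite: Andre1996Motifs, Thm. 7.2 (p. 35)] [cite: Huybrechts2023Cubic, Ch. 6 Prop. 3.19] -/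
@[conjecture] def HC_CubicFourfoldPowers : Prop :=
  ∀ ⦃X : SchemeOver ℂ⦄, Motives.IsSmoothHypersurface 4 3 X → ∀ m : ℕ, HodgeConjectureFor (m * 4) (X.pow m)

/-! ## Row 4 — Fermat hypersurfaces -/

/-- CITE + KERNEL (row 4): Fermat hypersurfaces `Xⁿₘ` inherit the Hodge conjecture from `HC_CM` (stage 2's target, a
fortiori from `HC_AV`) — Shioda–Katsura 1979 / Shioda 1979 inductive structure, BY NAME the tree theorem
`hodgeConjectureFor_fermat_of_cmHodgeHypothesis`, whose further displayed inputs are the printed theorems `hJ`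
(Koblitz–Rohrlich 1978: Fermat Jacobians are CM), `hSK` (`FermatHodgeClassesLiftToCurvePowersSum`) and `hJex` (Jacobians
exist).  `HC_CM` enters through `CorCM.hc_cm_iff_forall_cmHodgeHypothesisAt` (`Iff.rfl`).  NOTHING beyond `HC_CM`.
[cite: Shioda1979HodgeFermat, Thm. I] [cite: ShiodaKatsura1979, Thm. 1.7 and Prop. 2.4] -/
theorem hc_fermat_of_hc_cm (hCM : Summit.HodgeConjecture.CorCM.HC_CM)
    (hJ : ∀ (m : ℕ) (C : SchemeOver ℂ) (𝒥 : Motives.Jacobian C),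
      Motives.IsFermatVariety 1 m C → IsSmoothProjective 1 C → Milne1999.IsOfCMType 𝒥.J)
    (hSK : FermatHodgeClassesLiftToCurvePowersSum)
    (hJex : Motives.nonempty_jacobian_of_isSmoothProjective.{0}) :
    ∀ (n m : ℕ) (X : SchemeOver ℂ), 1 ≤ m → Motives.IsFermatVariety n m X → IsSmoothProjective n X →
      HodgeConjectureFor n X :=
  hodgeConjectureFor_fermat_of_cmHodgeHypothesis
    (Summit.HodgeConjecture.CorCM.hc_cm_iff_forall_cmHodgeHypothesisAt.mp hCM) hJ hSK hJex

/-! ## Row 5 — cohomology of Shimura varieties of abelian type -/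

/-- CITE (row 5), the only printed Hodge-conjecture statement for a class of Shimura varieties found: Bergeron–Millson–
Moeglin 2016 Cor. 2 (compact unitary ball quotients, degrees off the middle third), BY NAME the tree's registered open
statement `ShimuraVarieties.bmm2016_hodge_offMiddleThird` (conditional in print on the stabilization of the twisted
trace formula).  It does NOT pass through `HC_AV`; NO printed reduction of the Hodge conjecture for (the cohomology of)
abelian-type Shimura varieties to `HC_AV` was found (companion document §6: the printed reductions run the other way —
Abdulali 1994 Thm. 6.1, André 1996 §6.3 Rem. 2 — and this row is referred to stage 5). [cite: BergeronMillsonMoeglin2016Balls, Thm. 1 and Cor. 2]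
[cite: Abdulali1994FamiliesAV, Main Thm. 6.1 and Lemma 6.2 (p. 1131)] -/
theorem hc_ballQuotient_offMiddleThird (h : ShimuraVarieties.bmm2016_hodge_offMiddleThird) (p : ℕ) (X : SchemeOver ℂ)
    (hD : Nonempty (ShimuraVarieties.UnitaryBallQuotientDatum p X)) (hX : IsSmoothProjective p X) (n : ℕ) (hn : n ≤ p)
    (hthird : 3 * n ≤ p ∨ 2 * p ≤ 3 * n) (c : complexBetti X (2 * n)) (hc : IsRationalClass c)
    (hpp : IsOfHodgeType p X (2 * n) n n c) : c ∈ algebraicClasses X n :=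
  h p X hD hX n hn hthird c hc hpp

/-! ## Side-rung SR-1 — Grothendieck's standard conjecture of Lefschetz type `B` (conditions → object) -/

/-- SR-1 TARGET SHAPE, BY NAME: `B(X)` on real carriers is the tree's `StandardConjectureBStar d X η` (André's `*_L`-form,
Grothendieck 1969 §3); KNOWN for abelian varieties (Lieberman 1968 = `Lieberman1968_lefschetzInvolution_algebraic_abelianVariety`,
a named fact) and for `K3^[n]`-type (Charles–Markman 2013 Thm. 1.1, CITE owed); André §0.3 + Thm. 0.6.2: `B` for all
smooth projective complex varieties ⟹ `HC_AV` (kernel edge of the tree: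
`hodgeConjectureFor_of_standardConjectureB_of_motivated_of_cupProduct` needs in addition "Hodge ⟹ motivated", which
Thm. 0.6.2 supplies on abelian varieties).  Recorded as the conditions→object junction `B ⟹ HC_AV` (to be PROVED in the
tree from the André files; not asserted). [cite: Andre1996Motifs, §0.3 (p. 7), Thm. 0.6.2 (p. 9), §6.3 Remarque 2 (p. 33)]
[cite: Grothendieck1969StandardConjectures, §3] [cite: Lieberman1968, Thm. 3 (p. 372)] -/
@[conjecture] def HC_AV_of_B : Prop :=
  (∀ (d : ℕ) (Z : SchemeOver ℂ) (η : complexBetti Z 2), IsSmoothProjective d Z → StandardConjectureBStar d Z η) → HC_AV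

/-! ## Side-rung SR-2 — Cattani–Deligne–Kaplan 1995 (algebraicity of Hodge loci) -/

/-- SR-2, BY NAME: CDK 1995 Thm. 1.1 / Cor. 1.2 is catalogued in `Literature/Barriers/HodgeConjecture/HodgeLocusAlgebraic`
as `CattaniDeligneKaplan1995_hodgeLocus_algebraicFor D` (per geometric VHS datum `D`, framework `B`).  What it gives to
ring2's binder `AbelianSchemeVHC` / `Theses.AnchorTransport.VariationalHodge`: the components of the Hodge locus of a
flat class are ALGEBRAIC subvarieties of the base — so "algebraic on one fibre ⟹ algebraic on every fibre of the
component" is a statement about an algebraic family.  What it does NOT give: algebraicity of the class on any fibre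
(variational Hodge), nor the field of definition of the locus (CDK Introduction: "About this, we are not able to say
anything").  This abbreviation only fixes the name used by the ladder. [cite: CattaniDeligneKaplan1995JAMS, Thm. 1.1 and Cor. 1.2] -/
abbrev CDK_HodgeLocusAlgebraic (B : BettiHodgeData ℂ) {𝒳 S : SchemeOver ℂ} {f : 𝒳 ⟶ S} {n p : ℕ}
    (D : Motives.GeometricVHSData B f n (2 * p)) : Prop :=
  Literature.Barriers.HodgeConjecture.CattaniDeligneKaplan1995_hodgeLocus_algebraicFor B D


/-! ## Appended (literature seat `hodge-director-lit-stage4`, gen 2, 2026-08-21): row 2b typed; road (R1) kernel-typed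

Companion document v2 (same HOME path).  New Literature carriers/records used below, all BY NAME:
`Hyperkaehler.IsOfGeneralizedKummerType` (Beauville 1983 §7; definition request D1 of v1 §10),
`Hyperkaehler.Floccari2023_hodgeClasses_algebraic_kum3Type` (Floccari 2023 Thm. 1.1),
`Hyperkaehler.FloccariVaresco2024_hodgeClasses_algebraic_kum2Type` (Floccari–Varesco 2024 Cor. 1.2),
`Hyperkaehler.FloccariVaresco2024_degreeTwoGenerated_hodgeClasses_algebraic` (ibid. Thm. 1.1, with
`Hyperkaehler.degreeTwoGenerated X j = A₂^{2j}(X) ⊗ ℂ`), `Hyperkaehler.CharlesMarkman2013_lefschetzStandard_K3HilbertType`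
(Charles–Markman 2013 Thm. 1.1), `Hyperkaehler.Soldatenkov2022_hodgeClasses_motivated_K3HilbertType_or_kummerType`
(Soldatenkov 2022 Cor. 1.2 with §2.2 / André 1996 §6.3).  Consequences recorded here:
* row 2b has a TARGET (`HC_KummerType`; in print a THEOREM for `n = 2, 3` — CITE wirings `hc_kum2Type`,
  `hc_kum3Type` — and OPEN for `n ≥ 4` outside the subalgebra generated by `H²`, `hc_kummerType_degreeTwoGenerated`);
* the v1 junction shapes `HC_K3HilbertType_of_B` and `HC_AV_of_B` are now THEOREMS modulo named published
  facts (`hc_K3HilbertType_of_B_of_facts`, `hc_av_of_B_of_facts`): road (R1) — Grothendieck's `B` for all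
  smooth projective complex varieties — is kernel-typed for rows 2a, 2b and for stage 3's conclusion, and
  `HC_AV` is NOT among its inputs (as the v1 document says in prose).
-/

/-! ### Row 2b — hyperkähler varieties of generalized Kummer type -/

/-- TARGET (row 2b): the Hodge conjecture for every smooth projective variety of `Kumⁿ`-type, `n ≥ 2`
(`Hyperkaehler.IsOfGeneralizedKummerType`).  In print: a THEOREM for `n = 2` (Floccari–Varesco 2024
Cor. 1.2) and `n = 3` (Floccari 2023 Thm. 1.1), and for all `n` on the subalgebra generated by `H²`
(Floccari–Varesco 2024 Thm. 1.1); OPEN for `n ≥ 4` on its complement ("Theorem 1.1 is not sufficient to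
prove the Hodge conjecture for `X` (see [Green–Kim–Laza–Weyman 2019])", loc. cit.).
[cite: FloccariVaresco2024, Thm. 1.1 and Cor. 1.2 (§1)] [cite: Floccari2023, Thm. 1.1 (§1)] -/
@[conjecture] def HC_KummerType : Prop :=
  ∀ (n : ℕ), 2 ≤ n → ∀ ⦃X : SchemeOver ℂ⦄, IsSmoothProjective (2 * n) X → IsOfGeneralizedKummerType n X →
    HodgeConjectureFor (2 * n) X

/-- CITE (row 2b, `n = 2`), kernel wiring: Floccari–Varesco 2024 Cor. 1.2 BY NAME.
[cite: FloccariVaresco2024, Cor. 1.2 (§1)] -/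
theorem hc_kum2Type (h : Hyperkaehler.FloccariVaresco2024_hodgeClasses_algebraic_kum2Type) {X : SchemeOver ℂ}
    (hX : IsSmoothProjective 4 X) (hK : IsOfGeneralizedKummerType 2 X) : HodgeConjectureFor 4 X :=
  h hX hK

/-- CITE (row 2b, `n = 3`), kernel wiring: Floccari 2023 Thm. 1.1 BY NAME. [cite: Floccari2023, Thm. 1.1 (§1)] -/
theorem hc_kum3Type (h : Hyperkaehler.Floccari2023_hodgeClasses_algebraic_kum3Type) {X : SchemeOver ℂ}
    (hX : IsSmoothProjective 6 X) (hK : IsOfGeneralizedKummerType 3 X) : HodgeConjectureFor 6 X :=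
  h hX hK

/-- CITE (row 2b, all `n ≥ 2`, the subalgebra generated by `H²`), kernel wiring: Floccari–Varesco 2024
Thm. 1.1 BY NAME — a rational `(j, j)`-class lying in `A₂^{2j}(X) ⊗ ℂ` (`Hyperkaehler.degreeTwoGenerated X j`)
is algebraic. [cite: FloccariVaresco2024, Thm. 1.1 (§1)] -/
theorem hc_kummerType_degreeTwoGenerated
    (h : Hyperkaehler.FloccariVaresco2024_degreeTwoGenerated_hodgeClasses_algebraic) (n : ℕ) (hn : 2 ≤ n)
    {X : SchemeOver ℂ} (hX : IsSmoothProjective (2 * n) X) (hK : IsOfGeneralizedKummerType n X) (j : ℕ)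
    (c : complexBetti X (2 * j)) (hc : IsRationalClass c) (hjj : IsOfHodgeType (2 * n) X (2 * j) j j c)
    (hA : c ∈ Hyperkaehler.degreeTwoGenerated X j) : c ∈ algebraicClasses X j :=
  h n hn hX hK j c hc hjj hA

/-! ### Road (R1) kernel-typed: `B` for all smooth projective complex varieties ⟹ rows 2a, 2b and `HC_AV` -/

/-- Road (R1) for rows 2a and 2b: Grothendieck's `B` (algebraicity of `*_L`, the tree's
`StandardConjectureBStar`) for ALL smooth projective complex varieties ⟹ the Hodge conjecture for every
projective variety of `K3^[n]`- or `Kumⁿ`-type, GIVEN the named facts "Hodge ⟹ motivated" on such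
varieties (Soldatenkov 2022 Cor. 1.2 + André 1996 §6.3) and the multiplicativity of algebraic classes
(Voisin II Prop. 9.20) — through André 1996 §0.3 (under `B`, motivated = algebraic), PROVED in
`Literature` as `Hyperkaehler.Soldatenkov2022_….hodgeClasses_algebraic_of_lefschetzStandardB`.  `HC_AV` is
not an input. [cite: Andre1996Motifs, §0.3 (p. 7) and §2.1 (p. 14)] [cite: Soldatenkov2022, Cor. 1.2 and §2.2] -/
theorem hc_K3HilbertType_or_kummerType_of_B
    (hS : Hyperkaehler.Soldatenkov2022_hodgeClasses_motivated_K3HilbertType_or_kummerType)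
    (hcup : Voisin2003_cupProduct_algebraicClasses)
    (hB : ∀ (d : ℕ) (Z : SchemeOver ℂ) (η : complexBetti Z 2), IsSmoothProjective d Z → StandardConjectureBStar d Z η)
    {n : ℕ} {X : SchemeOver ℂ} (hX : IsSmoothProjective (2 * n) X)
    (hK : IsOfK3HilbertType n X ∨ IsOfGeneralizedKummerType n X) : HodgeConjectureFor (2 * n) X :=
  Hyperkaehler.Soldatenkov2022_hodgeClasses_motivated_K3HilbertType_or_kummerType.hodgeClasses_algebraic_of_lefschetzStandardB
    hS hcup hB hX hK

/-- **v1's junction shape `HC_K3HilbertType_of_B` DISCHARGED modulo named published facts** (and without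
using its displayed `HC_AV` hypothesis). [cite: Soldatenkov2022, Cor. 1.2 and §2.2]
[cite: Andre1996Motifs, §0.3 (p. 7)] -/
theorem hc_K3HilbertType_of_B_of_facts
    (hS : Hyperkaehler.Soldatenkov2022_hodgeClasses_motivated_K3HilbertType_or_kummerType)
    (hcup : Voisin2003_cupProduct_algebraicClasses) : HC_K3HilbertType_of_B :=
  fun hB _ _ _ _ hX hK ↦ hc_K3HilbertType_or_kummerType_of_B hS hcup hB hX (Or.inl hK)

/-- Road (R1) for row 2b: `B` for all ⟹ `HC_KummerType`, modulo the same two named facts.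
[cite: Soldatenkov2022, Cor. 1.2 and §2.2] [cite: Andre1996Motifs, §0.3 (p. 7)] -/
theorem hc_kummerType_of_B
    (hS : Hyperkaehler.Soldatenkov2022_hodgeClasses_motivated_K3HilbertType_or_kummerType)
    (hcup : Voisin2003_cupProduct_algebraicClasses)
    (hB : ∀ (d : ℕ) (Z : SchemeOver ℂ) (η : complexBetti Z 2), IsSmoothProjective d Z → StandardConjectureBStar d Z η) :
    HC_KummerType :=
  fun _ _ _ hX hK ↦ hc_K3HilbertType_or_kummerType_of_B hS hcup hB hX (Or.inr hK)

/-- **v1's junction shape `HC_AV_of_B` DISCHARGED modulo named published facts**: `B` for all smooth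
projective complex varieties ⟹ `HC_AV`, GIVEN André 1996 Thm. 0.6.2 BY NAME (Hodge classes on abelian
varieties are motivated, `Andre1996_hodgeClasses_abelianVariety_motivated`) and Voisin II Prop. 9.20
(`Voisin2003_cupProduct_algebraicClasses`); abelian varieties are smooth projective by the tree's PROVED
`Motives.AbelianVariety.isSmoothProjective_holds`, Hodge models exist by `nonempty_hodgeModel_holds`, and
under `B` motivated classes are algebraic (André §0.3, the tree's
`Andre1996_motivatedClasses_le_algebraicClasses_of_standardConjectureB_holds_of`).  This is André 1996 §6.3
Remarque 2 (p. 33) in kernel form. [cite: Andre1996Motifs, Thm. 0.6.2 (p. 9), §0.3 (p. 7) and §6.3 Remarque 2 (p. 33)] -/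
theorem hc_av_of_B_of_facts (hA : Andre1996_hodgeClasses_abelianVariety_motivated)
    (hcup : Voisin2003_cupProduct_algebraicClasses) : HC_AV_of_B := fun hB A ↦
  have hsp : IsSmoothProjective A.dim A.X := Motives.AbelianVariety.isSmoothProjective_holds
  ⟨nonempty_hodgeModel_holds hsp, fun p c hc hpp ↦
    Andre1996_motivatedClasses_le_algebraicClasses_of_standardConjectureB_holds_of hcup hB hsp p
      (hA A hsp p c hc hpp)⟩

/-! ### Side-rung SR-1, CITE owed in v1: `B` for `K3^[n]`-type (Charles–Markman 2013) -/

/-- CITE (SR-1), kernel wiring: Charles–Markman 2013 Thm. 1.1 BY NAME — `B(X)` for every smooth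
projective `X` of `K3^[n]`-type (e.g. `F(Y)` of a cubic fourfold `Y`, row 3). [cite: CharlesMarkman2013, Thm. 1.1 (§1)] -/
theorem b_K3HilbertType (h : Hyperkaehler.CharlesMarkman2013_lefschetzStandard_K3HilbertType) (n : ℕ)
    {X : SchemeOver ℂ} (hX : IsSmoothProjective (2 * n) X) (hK : IsOfK3HilbertType n X)
    (η : complexBetti X 2) : StandardConjectureBStar (2 * n) X η :=
  h n hX hK η

/-! ### Absolute Hodge (the Deligne 1982 input of the coordinator's list), rows 2a/2b -/

/-- CITE, kernel wiring: Soldatenkov 2022 Cor. 1.3 BY NAME (derived in `Literature` from Cor. 1.2 and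
André 1996 Prop. 2.5.1 exactly as printed) — every Hodge class on a projective `K3^[n]`- or `Kumⁿ`-type
variety is an absolute Hodge class.  What it gives the ladder: the "kill criterion" of the motivated
road is met (no Hodge class on these varieties can fail to be absolute Hodge); what it does NOT give:
algebraicity. [cite: Soldatenkov2022, Cor. 1.3 (§1.2)] [cite: Andre1996Motifs, Prop. 2.5.1 (p. 18)] -/
theorem hodgeClasses_absoluteHodge_K3HilbertType_or_kummerType
    (hS : Hyperkaehler.Soldatenkov2022_hodgeClasses_motivated_K3HilbertType_or_kummerType)
    (hA : Andre1996_isAbsoluteHodgeClass_of_mem_motivatedClasses) {n : ℕ} {X : SchemeOver ℂ}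
    (hX : IsSmoothProjective (2 * n) X) (hK : IsOfK3HilbertType n X ∨ IsOfGeneralizedKummerType n X)
    (p : ℕ) (c : complexBetti X (2 * p)) (hc : IsRationalClass c) (hpp : IsOfHodgeType (2 * n) X (2 * p) p p c) :
    IsAbsoluteHodgeClass (2 * n) X p c :=
  Hyperkaehler.Soldatenkov2022_hodgeClasses_motivated_K3HilbertType_or_kummerType.hodgeClasses_absoluteHodge_of
    hS hA hX hK p c hc hpp


/-! ## Appended (literature seat `hodge-director-lit-stage4`, gen 2, v2.1): road (R1) modulo ONE named fact

The multiplicativity input `Voisin2003_cupProduct_algebraicClasses` of the v2 theorems is a THEOREM of the tree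
on the summit side (`Summit.HodgeConjecture.HodgeConjecture.Theorems.Voisin2003_cupProduct_algebraicClasses_holds`,
file `Theorems/EndoscopicMiddleDegreeCupProductAlgebraic`; used the same way by ring 2's
`Theorems/Ring2LitMotivatedClassesOfStandardB`).  Feeding it in: road (R1) for rows 2a/2b holds modulo the
SINGLE named fact `Hyperkaehler.Soldatenkov2022_hodgeClasses_motivated_K3HilbertType_or_kummerType`
(Soldatenkov 2022 Cor. 1.2 with §2.2) and Grothendieck's `B` for all smooth projective complex varieties; and
SR-1's `HC_AV_of_B` holds modulo André 1996 Thm. 0.6.2 alone — the latter is ring 2's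
`Ring2.Hypotheses.hc_av_of_B_of_andre1996` (`Theorems/Ring2HypothesesStage4Seam`, p239906), re-derived here
from `hc_av_of_B_of_facts` only so that this file's own statement list is complete; ring 2's theorem is the
reference form.
-/

/-- Road (R1), rows 2a: `B` for all ⟹ `HC_K3HilbertType`, modulo ONE named fact (Soldatenkov 2022 Cor. 1.2
with §2.2; André 1996 §6.3); the cup-product step is the tree's theorem
`HodgeConjecture.Theorems.Voisin2003_cupProduct_algebraicClasses_holds`; `HC_AV` is not an input.
[cite: Soldatenkov2022, Cor. 1.2 and §2.2] [cite: Andre1996Motifs, §0.3 (p. 7) and §2.1 (p. 14)] -/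
theorem hc_K3HilbertType_of_B_of_soldatenkov
    (hS : Hyperkaehler.Soldatenkov2022_hodgeClasses_motivated_K3HilbertType_or_kummerType) :
    HC_K3HilbertType_of_B :=
  hc_K3HilbertType_of_B_of_facts hS
    Summit.HodgeConjecture.HodgeConjecture.Theorems.Voisin2003_cupProduct_algebraicClasses_holds

/-- Road (R1), row 2b: `B` for all ⟹ `HC_KummerType`, modulo the same single named fact.
[cite: Soldatenkov2022, Cor. 1.2 and §2.2] [cite: Andre1996Motifs, §0.3 (p. 7) and §2.1 (p. 14)] -/
theorem hc_kummerType_of_B_of_soldatenkov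
    (hS : Hyperkaehler.Soldatenkov2022_hodgeClasses_motivated_K3HilbertType_or_kummerType)
    (hB : ∀ (d : ℕ) (Z : SchemeOver ℂ) (η : complexBetti Z 2), IsSmoothProjective d Z → StandardConjectureBStar d Z η) :
    HC_KummerType :=
  hc_kummerType_of_B hS
    Summit.HodgeConjecture.HodgeConjecture.Theorems.Voisin2003_cupProduct_algebraicClasses_holds hB

/-- SR-1 modulo André 1996 Thm. 0.6.2 ALONE (`Andre1996_hodgeClasses_abelianVariety_motivated`): the same
statement as ring 2's `Ring2.Hypotheses.hc_av_of_B_of_andre1996` (the reference form, p239906), obtained here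
from `hc_av_of_B_of_facts` and the tree's cup-product theorem. [cite: Andre1996Motifs, Thm. 0.6.2 (p. 9) and §6.3 Remarque 2 (p. 33)] -/
theorem hc_av_of_B_of_andre1996_thm_0_6_2 (hA : Andre1996_hodgeClasses_abelianVariety_motivated) : HC_AV_of_B :=
  hc_av_of_B_of_facts hA
    Summit.HodgeConjecture.HodgeConjecture.Theorems.Voisin2003_cupProduct_algebraicClasses_holds

end Summit.HodgeConjecture.CorCM.Stage4
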